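import Summits.QuantumFields.YangMills.Theorems.BalabanUVNodesK0Stub2OfSockGamma
import Literature.MathematicalPhysics.QuantumFieldTheory.Balaban1983to89.Node00.CarriersB8CubePrint

/-!
# K0⁷ STUB 2′ (plan g79 (R-b): [6] Prop. 6 AT NODE 00's PRINT-FAITHFUL CUBES `zdCubP (MatA 2) F.L ρ₀`) — THE K0-SIDE JUNCTIONS: the 2′ body from a PER-CUBE
# Proposition-6 letter carrying print's p. 98 side conditions (the flat line's shape; big-block size `ρ₀` CHOSEN from the letter's thresholds), and from the γ socket
# road (FULL ⇒ PRINT-CUT)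

Cell `pub-ymgap`, width seat `pub-ymgap-k0-s2-w1` (g0; director-ym №197 ∕ HUMAN RULING D-0149).  `--kind proof --supports stmt-QuantumFields-20541 --as helper`.
[6] = [Balaban1985RegularSpaces]; [4] = [Balaban1985BackgroundPropagators]; [B6] = [Balaban1984PropagatorsII]; [I] = [Balaban1987RG1].

CONTEXT (plan g79 WORD-B1-DECLARER, bus 2026-08-27 23:35Z; dag-n05-e LOCATED-CARRIER; k0-s2-w2 `K0Stub2DatumForm` p584299 + (b1) `Node00/CarriersB8CubePrint`).  V18 stub 2
reads [6] Prop. 6 at EVERY `Node00.CubeB8` cube (collars `ρ = L` included — beyond print's p. 98 cubes); the repair chain (R-b) re-cuts it to STUB 2′ = `∀ F, ∃ ρ₀ B₁ c₁, 1 ≤ ρ₀ ∧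
0 ≤ B₁ ∧ 0 < c₁ ∧ B8.Prop6Printed 4 (F.L : ℝ) B₁ c₁ (fun i : ZdIdx 4 F.L => zdCubP (MatA 2) F.L ρ₀ i)` (print's class `CubeB8.IsPrint ρ₀`: `ρ₀ ∣ c.ρ`, `ρ₀ ∣ c.M`,
corner on the `ρ₀`-grid; V19 only after (b1)–(b3) land; V18 STANDS).  The plan's word to this seat: «your per-cube letters feed 2′ via `prop6Printed_zdCubP_iff` at a common
multiple ρ₀».  THIS FILE types exactly that junction, SUPPLIER-AGNOSTIC: whatever proves Proposition 6's conclusion `GaugedBoundB8` PER CUBE above print's p. 98 thresholds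
(dag-n05-e's flat line γ, endpoint Fγ10 from dag-n05-c's ONE named fact `Ineq159FlatCubeMemberPrinted`; or any other per-cube letter of the same shape) closes 2′ by ONE
`exact`, the big-block size `ρ₀` being CHOSEN here from the letter's thresholds `(ρ₀′, M₀, N₀)`.

WHAT THIS FILE PROVES (theorems only; 0 `def`; nothing of Bałaban asserted).
§1 `exists_bigBlock_of_thresholds` — ARITHMETIC: for `L ≥ 1` and any thresholds `M₀ ρ₀′ : ℝ`, `N₀ : ℕ` there are `ρ₀ Mh R : ℕ` with `1 ≤ ρ₀`, `3 ≤ Mh`, `M₀ ≤ L·Mh`,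
   `Mh·L ∣ ρ₀`, `R·(Mh·L) ≤ ρ₀`, `2L ≤ R`, `N₀ + 1 ≤ R·(L·Mh)`, `ρ₀′ ≤ ρ₀` — so that EVERY print cube at `ρ₀` meets the p. 98 binder list of the per-cube letters
   (k0-s2-w2's `CubeB8.IsPrint.sideConditions_of_dvd`).
§2 ★★★ `prop6MemberB8AtP_of_perCubeLetter` — THE JUNCTION: a per-cube Proposition-6 letter of the flat line's shape at `𝔸 = M₂(ℂ)`, `d = 4`, some `B₁ ≥ 0` —
   «`∃ c₁ ρ₀′ M₀ N₀, 0 < c₁ ∧ ∀ η > 0, ∀ {K Ω} (c : CubeB8 4 F.L K Ω), ∀ Mh R, 3 ≤ Mh → M₀ ≤ L·Mh → Mh·L ∣ c.ρ → Mh·L ∣ c.M → R·(Mh·L) ≤ c.ρ → 2L ≤ R → N₀+1 ≤ R·(L·Mh) →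
   ρ₀′ ≤ c.ρ → ∀ U₀ unitary, ∀ α₀ > 0, InAk L K η α₀ Ω U₀ → 7·4·L²·c.M·α₀ ≤ c₁ → GaugedBoundB8 L η U₀ c (7·4·L²·B₁·c.M·α₀)`» ⟹ STUB 2′'s BODY at `F`
   (`ρ₀` from §1; `prop6Printed_zdCubP_iff`).
§2b `exists_powBlock_of_thresholds` · ★★★ `prop6MemberB8AtP_of_perCubeLetterPow` — the same junction keyed on the NAMED FACT's letter shape (big blocks `M_h = Lˢ`, extra
   threshold `R₀ ≤ R`) = dag-n05-e g10's crown Fγ10b `gaugedBoundB8_cubeMember_scalar_γ_of_ineq159Printed` at `d = 4`, `𝔸 = M₂(ℂ)` (bus 2026-08-28 00:38Z): 2′ modulo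
   `Ineq159FlatCubeMemberPrinted 4 F.L` ONLY once Fγ10b lands (the one-line composition is a v1.1 of this file).
§3 `prop6MemberB8AtP_of_prop6Member` (V18 body ⇒ 2′ body at `ρ₀ = 1`, FULL ⇒ CUT: `prop6Printed_zdCubP_of_zdCub`) · `prop6MemberB8AtP_of_sockγ` · ★ `prop6MemberB8AtP_of_thm33γ`
   (2′ from the γ socket road (E) `K0Stub2OfSockGamma`, same displayed hypotheses).

HONEST SCOPE ∕ A6 (director-ym №189 (3)).  K0-side bookkeeping + elementary arithmetic; every analytic input is a DISPLAYED HYPOTHESIS: §2's per-cube letter (NOT in tree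
unconditionally tonight — dag-n05-e g10's Fγ10 will state it modulo dag-n05-c's named flat (1.59) `Ineq159FlatCubeMemberPrinted`, OPEN, transplant T2–T4), §3's socket
families ∕ Thm 3.3 + binders (as in (E)).  Stub 2′ is WEAKER than stub 2 (print's class only); V18 of record is NOT touched; nothing here closes 20541.  Counts unmoved
(typed 28∕28 · discharged 5∕27); one finite 𝕋⁴ programme at fixed `ε = L^{−K}`, Bałaban AS PRINTED — NOT continuum ∕ ℝ⁴ ∕ OS ∕ mass gap ∕ Clay: the Yang–Mills mass gap is
NOT proved by any of this; route R4 closes the CONDITIONAL finite-𝕋⁴ rung `BalabanLadder.UV` only.  No `sorry`, `def`, `instance`, `notation`; standard axioms.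
-/

noncomputable section

open scoped Matrix.Norms.L2Operator

namespace Summit.QuantumFields.YangMills.Theorems.K0Stub2PrimeJunction

open Literature.MathematicalPhysics.QuantumFieldTheory.Balaban1983to89
open Literature.MathematicalPhysics.QuantumFieldTheory.Balaban1983to89.Node00
open Literature.MathematicalPhysics.QuantumFieldTheory.Balaban1983to89.T4Continuum
open Literature.MathematicalPhysics.QuantumFieldTheory.Balaban1983to89.FlowStep
open Literature.MathematicalPhysics.QuantumFieldTheory.Balaban1983to89.B8LeafModelZd (ZdIdx SockP5base SockP5)
open Literature.MathematicalPhysics.QuantumFieldTheory.Balaban1983to89.B7Prop2Explicit (unitaryUnits)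
open Literature.MathematicalPhysics.QuantumFieldTheory.Balaban1983to89.B8Ineq132 (InAk)
open Literature.MathematicalPhysics.QuantumFieldTheory.Balaban1983to89.B8Eq131CubesAdmissible (cubeFam)
open Literature.MathematicalPhysics.QuantumFieldTheory.Balaban1983to89.B8CubeMemberZd (cubeLamS cubeLamB)
open Literature.MathematicalPhysics.QuantumFieldTheory.Balaban1983to89.B9SupplySockB9P3ZdBeta (SockB9P3D4β)
open Literature.MathematicalPhysics.QuantumFieldTheory.Balaban1983to89.B9SupplySockB9P3ZdGamma (cubeLamBP' AvgAtγ)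
open Literature.MathematicalPhysics.QuantumFieldTheory.Balaban1983to89.B9SupplySockB9P3ZdLetters (OpsZd)
open Literature.MathematicalPhysics.QuantumFieldTheory.Balaban1983to89.B9SupplySockB9P3ZdAt (DictAt Prop6At InvAt CurvAt LandauAt)
open Summit.QuantumFields.YangMills.Theorems.K0Stub2OfSockGamma (prop6MemberB8At_of_sockγ prop6MemberB8At_of_thm33γ)

variable (F : T4Family)

/-! ## §1 Choosing the big-block size from the thresholds -/

/-- **A BIG-BLOCK SIZE MEETING ALL OF PRINT'S p. 98 THRESHOLDS EXISTS** (`L ≥ 1`): `Mh := max 3 ⌈M₀⌉₊`, `R := max (2L) (N₀ + 1)`, `ρ₀ := (Mh·L)·(R·max 1 ⌈ρ₀′⌉₊)`.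
Elementary arithmetic; print's «R₁, M₁ are smallest integers for which all the theorems of the papers [2, 4] are valid» — here any integers above the thresholds.
[cite: Balaban1985RegularSpaces, p.98 («M is a multiple of R₁M₁ … distance … equal to R₁M₁Lʲη»)] -/
theorem exists_bigBlock_of_thresholds {L : ℕ} (hL : 1 ≤ L) (M₀ ρ₀' : ℝ) (N₀ : ℕ) :
    ∃ ρ₀ Mh R : ℕ, 1 ≤ ρ₀ ∧ 3 ≤ Mh ∧ M₀ ≤ (L : ℝ) * Mh ∧ Mh * L ∣ ρ₀ ∧ R * (Mh * L) ≤ ρ₀ ∧ 2 * L ≤ R ∧ N₀ + 1 ≤ R * (L * Mh) ∧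
      ρ₀' ≤ (ρ₀ : ℝ) := by
  set Mh : ℕ := max 3 ⌈M₀⌉₊ with hMh
  set R : ℕ := max (2 * L) (N₀ + 1) with hR
  set t : ℕ := max 1 ⌈ρ₀'⌉₊ with ht
  have hMh3 : 3 ≤ Mh := le_max_left _ _
  have hR2 : 2 * L ≤ R := le_max_left _ _
  have hRN : N₀ + 1 ≤ R := le_max_right _ _
  have ht1 : 1 ≤ t := le_max_left _ _
  have hMhL : 1 ≤ Mh * L := Nat.one_le_iff_ne_zero.2 (Nat.mul_ne_zero (by omega) (by omega))
  have hR1 : 1 ≤ R := le_trans (by omega) hR2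
  refine ⟨Mh * L * (R * t), Mh, R, ?_, hMh3, ?_, Dvd.intro _ rfl, ?_, hR2, ?_, ?_⟩
  · exact Nat.one_le_iff_ne_zero.2 (Nat.mul_ne_zero (by omega) (Nat.mul_ne_zero (by omega) (by omega)))
  · have h1 : M₀ ≤ ⌈M₀⌉₊ := Nat.le_ceil M₀
    have h2 : (⌈M₀⌉₊ : ℝ) ≤ Mh := by exact_mod_cast le_max_right 3 ⌈M₀⌉₊
    have h3 : (Mh : ℝ) ≤ (L : ℝ) * Mh := le_mul_of_one_le_left (Nat.cast_nonneg _) (by exact_mod_cast hL)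
    linarith
  · calc R * (Mh * L) = Mh * L * (R * 1) := by ring
      _ ≤ Mh * L * (R * t) := Nat.mul_le_mul_left _ (Nat.mul_le_mul_left _ ht1)
  · calc N₀ + 1 ≤ R := hRN
      _ = R * 1 := (mul_one _).symm
      _ ≤ R * (L * Mh) := Nat.mul_le_mul_left _ (by rw [mul_comm]; exact hMhL)
  · have h1 : ρ₀' ≤ ⌈ρ₀'⌉₊ := Nat.le_ceil ρ₀'
    have h2 : (⌈ρ₀'⌉₊ : ℝ) ≤ t := by exact_mod_cast le_max_right 1 ⌈ρ₀'⌉₊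
    have h3 : (t : ℝ) ≤ ((Mh * L * (R * t) : ℕ) : ℝ) := by
      have : t ≤ Mh * L * (R * t) := by
        calc t = 1 * (1 * t) := by ring
          _ ≤ Mh * L * (R * t) := Nat.mul_le_mul hMhL (Nat.mul_le_mul_right _ hR1)
      exact_mod_cast this
    linarith

/-! ## §2 ★★★ The junction: a per-cube Proposition-6 letter above print's thresholds closes stub 2′ -/

/-- **★★★ STUB 2′'s BODY FROM A PER-CUBE PROPOSITION-6 LETTER CARRYING PRINT's p. 98 SIDE CONDITIONS** (the flat line's shape at `𝔸 = M₂(ℂ)`, `d = 4`, some `B₁ ≥ 0`): choose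
the big-block size `ρ₀` with §1 from the letter's thresholds `(ρ₀′, M₀, N₀)`; every print cube `c` at `ρ₀` (`c.IsPrint ρ₀`) then meets the letter's binders `Mh·L ∣ c.ρ`,
`Mh·L ∣ c.M`, `R·(Mh·L) ≤ c.ρ`, `ρ₀′ ≤ c.ρ` (k0-s2-w2's `CubeB8.IsPrint.sideConditions_of_dvd`), so the letter gives `GaugedBoundB8` at `c`, i.e. `B8.Prop6Printed 4 L B₁ c₁`
on `zdCubP (MatA 2) F.L ρ₀` (`prop6Printed_zdCubP_iff`).  [cite: Balaban1985RegularSpaces, Prop. 6 (1.135)–(1.138) p.99, p.98 («R₁, M₁ … M is a multiple of R₁M₁ … distance … R₁M₁Lʲη … □_j is a sum of the big blocks»)] -/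
theorem prop6MemberB8AtP_of_perCubeLetter {B₁ : ℝ} (hB₁ : 0 ≤ B₁)
    (H : letI : CStarAlgebra (MatA 2) := {};
      ∃ c₁ ρ₀' M₀ : ℝ, ∃ N₀ : ℕ, 0 < c₁ ∧ ∀ (η : ℝ), 0 < η → ∀ {K : ℕ} {Ω : ℕ → Set (B7Prop1Explicit.Site 4)} (c : CubeB8 4 F.L K Ω),
        ∀ (Mh R : ℕ), 3 ≤ Mh → M₀ ≤ (F.L : ℝ) * Mh → Mh * F.L ∣ c.ρ → Mh * F.L ∣ c.M → R * (Mh * F.L) ≤ c.ρ → 2 * F.L ≤ R →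
          N₀ + 1 ≤ R * (F.L * Mh) → ρ₀' ≤ (c.ρ : ℝ) →
        ∀ (U₀ : B7Prop1Explicit.Site 4 → Fin 4 → (MatA 2)ˣ), (∀ x κ, U₀ x κ ∈ unitaryUnits (MatA 2)) → ∀ (α₀ : ℝ), 0 < α₀ → InAk F.L K η α₀ Ω U₀ →
        7 * (4 : ℕ) * (F.L : ℝ) ^ 2 * c.M * α₀ ≤ c₁ →
        GaugedBoundB8 F.L η U₀ c (7 * (4 : ℕ) * (F.L : ℝ) ^ 2 * B₁ * c.M * α₀)) :
    ∃ ρ₀ : ℕ, ∃ B₁ c₁ : ℝ, 1 ≤ ρ₀ ∧ 0 ≤ B₁ ∧ 0 < c₁ ∧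
      (letI : CStarAlgebra (MatA 2) := {}; B8.Prop6Printed 4 (F.L : ℝ) B₁ c₁ (fun i : ZdIdx 4 F.L => zdCubP (MatA 2) F.L ρ₀ i)) := by
  letI : CStarAlgebra (MatA 2) := {}
  have hL1 : 1 ≤ F.L := by have := F.hL11; omega
  obtain ⟨c₁, ρ₀', M₀, N₀, hc₁, G⟩ := H
  obtain ⟨ρ₀, Mh, R, hρ₀, hMh, hM₀, hdvd, hR, h2L, hN₀, hρ₀'⟩ := exists_bigBlock_of_thresholds hL1 M₀ ρ₀' N₀
  refine ⟨ρ₀, B₁, c₁, hρ₀, hB₁, hc₁, ?_⟩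
  rw [prop6Printed_zdCubP_iff]
  intro j α₀ hα U₀ hInA c hc hs
  obtain ⟨h1, h2, h3, h4⟩ := hc.sideConditions_of_dvd hL1 hdvd hR hρ₀'
  exact G j.η j.hη c Mh R hMh hM₀ h1 h2 h3 h2L hN₀ h4 U₀.1 U₀.2 α₀ hα hInA hs


/-! ## §2b The same junction for the NAMED FACT's letter shape (big blocks `M_h = Lˢ`, extra threshold `R₀`) -/

/-- **A POWER-OF-`L` BIG BLOCK MEETING THE NAMED FACT's THRESHOLDS EXISTS** (`L ≥ 2`): `s := max 2 ⌈M₀⌉₊` (so `3 ≤ Lˢ`, `M₀ ≤ Lˢ ≤ L^{s+1}`),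
`R := max (2L) (max R₀ (N₀ + 1))`, `ρ₀ := L^{s+1}·(R·max 1 ⌈ρ₀′⌉₊)`.  Elementary arithmetic (dag-n05-c's `Ineq159FlatCubeMemberPrinted` quantifies its cube data this way).
[cite: Balaban1985RegularSpaces, p.98 («M is a multiple of R₁M₁ … distance … equal to R₁M₁Lʲη»)] -/
theorem exists_powBlock_of_thresholds {L : ℕ} (hL : 2 ≤ L) (M₀ ρ₀' : ℝ) (N₀ R₀ : ℕ) :
    ∃ ρ₀ s R : ℕ, 1 ≤ ρ₀ ∧ 3 ≤ L ^ s ∧ M₀ ≤ (L : ℝ) ^ (s + 1) ∧ L ^ (s + 1) ∣ ρ₀ ∧ R * L ^ (s + 1) ≤ ρ₀ ∧ 2 * L ≤ R ∧ R₀ ≤ R ∧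
      N₀ + 1 ≤ R * L ^ (s + 1) ∧ ρ₀' ≤ (ρ₀ : ℝ) := by
  set s : ℕ := max 2 ⌈M₀⌉₊ with hs
  set R : ℕ := max (2 * L) (max R₀ (N₀ + 1)) with hR
  set t : ℕ := max 1 ⌈ρ₀'⌉₊ with ht
  have hs2 : 2 ≤ s := le_max_left _ _
  have hR2 : 2 * L ≤ R := le_max_left _ _
  have hRR : R₀ ≤ R := (le_max_left _ _).trans (le_max_right _ _)
  have hRN : N₀ + 1 ≤ R := (le_max_right _ _).trans (le_max_right _ _)
  have ht1 : 1 ≤ t := le_max_left _ _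
  have hL1 : 1 ≤ L := le_trans (by norm_num) hL
  have hLs1 : 1 ≤ L ^ (s + 1) := Nat.one_le_pow _ _ hL1
  have hR1 : 1 ≤ R := le_trans (by omega) hR2
  -- `Lˢ ≥ 2ˢ ≥ s + 1 ≥ 3` and `Lˢ ≥ s ≥ ⌈M₀⌉₊`
  have h2s : s + 1 ≤ 2 ^ s := Nat.succ_le_of_lt (Nat.lt_two_pow_self)
  have hLs : 2 ^ s ≤ L ^ s := Nat.pow_le_pow_left hL s
  have h3 : 3 ≤ L ^ s := by omega
  have hsM : ⌈M₀⌉₊ ≤ L ^ s := ((le_max_right 2 ⌈M₀⌉₊).trans (by omega : s ≤ 2 ^ s)).trans hLs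
  refine ⟨L ^ (s + 1) * (R * t), s, R, ?_, h3, ?_, Dvd.intro _ rfl, ?_, hR2, hRR, ?_, ?_⟩
  · exact Nat.one_le_iff_ne_zero.2 (Nat.mul_ne_zero (by omega) (Nat.mul_ne_zero (by omega) (by omega)))
  · have h1 : M₀ ≤ ⌈M₀⌉₊ := Nat.le_ceil M₀
    have h2 : (⌈M₀⌉₊ : ℝ) ≤ ((L ^ s : ℕ) : ℝ) := by exact_mod_cast hsM
    have h3 : ((L ^ s : ℕ) : ℝ) ≤ (L : ℝ) ^ (s + 1) := by
      rw [Nat.cast_pow, pow_succ]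
      exact le_mul_of_one_le_right (by positivity) (by exact_mod_cast hL1)
    linarith
  · calc R * L ^ (s + 1) = L ^ (s + 1) * (R * 1) := by ring
      _ ≤ L ^ (s + 1) * (R * t) := Nat.mul_le_mul_left _ (Nat.mul_le_mul_left _ ht1)
  · calc N₀ + 1 ≤ R := hRN
      _ = R * 1 := (mul_one _).symm
      _ ≤ R * L ^ (s + 1) := Nat.mul_le_mul_left _ hLs1
  · have h1 : ρ₀' ≤ ⌈ρ₀'⌉₊ := Nat.le_ceil ρ₀'
    have h2 : (⌈ρ₀'⌉₊ : ℝ) ≤ t := by exact_mod_cast le_max_right 1 ⌈ρ₀'⌉₊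
    have h3 : (t : ℝ) ≤ ((L ^ (s + 1) * (R * t) : ℕ) : ℝ) := by
      have : t ≤ L ^ (s + 1) * (R * t) := by
        calc t = 1 * (1 * t) := by ring
          _ ≤ L ^ (s + 1) * (R * t) := Nat.mul_le_mul hLs1 (Nat.mul_le_mul_right _ hR1)
      exact_mod_cast this
    linarith

/-- **★★★ STUB 2′'s BODY FROM A PER-CUBE PROPOSITION-6 LETTER IN THE NAMED FACT's SHAPE** (big blocks `Lˢ`; dag-n05-e g10's crown Fγ10b
`gaugedBoundB8_cubeMember_scalar_γ_of_ineq159Printed` at `d = 4`, `𝔸 = M₂(ℂ)` has exactly this conclusion, with `B₁ = 5·4·L·B₀`): choose the big-block size with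
`exists_powBlock_of_thresholds`; every print cube at it meets the letter's binders (`CubeB8.IsPrint.sideConditions_of_dvd` at `Mh := Lˢ`); `prop6Printed_zdCubP_iff`.
[cite: Balaban1985RegularSpaces, Prop. 6 (1.135)–(1.138) p.99, p.98] -/
theorem prop6MemberB8AtP_of_perCubeLetterPow {B₁ : ℝ} (hB₁ : 0 ≤ B₁)
    (H : letI : CStarAlgebra (MatA 2) := {};
      ∃ c₁ ρ₀' M₀ : ℝ, ∃ N₀ R₀ : ℕ, 0 < c₁ ∧ ∀ (η : ℝ), 0 < η → ∀ {K : ℕ} {Ω : ℕ → Set (B7Prop1Explicit.Site 4)} (c : CubeB8 4 F.L K Ω),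
        ∀ (s R : ℕ), 3 ≤ F.L ^ s → M₀ ≤ (F.L : ℝ) ^ (s + 1) → F.L ^ (s + 1) ∣ c.ρ → F.L ^ (s + 1) ∣ c.M → R * F.L ^ (s + 1) ≤ c.ρ → 2 * F.L ≤ R →
          R₀ ≤ R → N₀ + 1 ≤ R * F.L ^ (s + 1) → ρ₀' ≤ (c.ρ : ℝ) →
        ∀ (U₀ : B7Prop1Explicit.Site 4 → Fin 4 → (MatA 2)ˣ), (∀ x κ, U₀ x κ ∈ unitaryUnits (MatA 2)) → ∀ (α₀ : ℝ), 0 < α₀ → InAk F.L K η α₀ Ω U₀ →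
        7 * (4 : ℕ) * (F.L : ℝ) ^ 2 * c.M * α₀ ≤ c₁ →
        GaugedBoundB8 F.L η U₀ c (7 * (4 : ℕ) * (F.L : ℝ) ^ 2 * B₁ * c.M * α₀)) :
    ∃ ρ₀ : ℕ, ∃ B₁ c₁ : ℝ, 1 ≤ ρ₀ ∧ 0 ≤ B₁ ∧ 0 < c₁ ∧
      (letI : CStarAlgebra (MatA 2) := {}; B8.Prop6Printed 4 (F.L : ℝ) B₁ c₁ (fun i : ZdIdx 4 F.L => zdCubP (MatA 2) F.L ρ₀ i)) := by
  letI : CStarAlgebra (MatA 2) := {}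
  have hL1 : 1 ≤ F.L := by have := F.hL11; omega
  have hL2 : 2 ≤ F.L := by have := F.hL11; omega
  obtain ⟨c₁, ρ₀', M₀, N₀, R₀, hc₁, G⟩ := H
  obtain ⟨ρ₀, s, R, hρ₀, h3, hM₀, hdvd, hR, h2L, hR₀, hN₀, hρ₀'⟩ := exists_powBlock_of_thresholds hL2 M₀ ρ₀' N₀ R₀
  refine ⟨ρ₀, B₁, c₁, hρ₀, hB₁, hc₁, ?_⟩
  rw [prop6Printed_zdCubP_iff]
  intro j α₀ hα U₀ hInA c hc hs
  -- the letter's `Mh·L` is `Lˢ·L = L^{s+1}`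
  have hdvd' : F.L ^ s * F.L ∣ ρ₀ := by rw [← pow_succ]; exact hdvd
  have hR' : R * (F.L ^ s * F.L) ≤ ρ₀ := by rw [← pow_succ]; exact hR
  obtain ⟨h1, h2, h3', h4⟩ := hc.sideConditions_of_dvd hL1 hdvd' hR' hρ₀'
  rw [← pow_succ] at h1 h2 h3'
  exact G j.η j.hη c s R h3 hM₀ h1 h2 h3' h2L hR₀ hN₀ h4 U₀.1 U₀.2 α₀ hα hInA hs

/-! ## §3 Stub 2′ from V18's body and from the γ socket road (FULL ⇒ PRINT-CUT) -/

/-- **V18's STUB-2 BODY IMPLIES STUB 2′'s BODY** (at `ρ₀ = 1`; FULL ⇒ CUT by k0-s2-w2's `prop6Printed_zdCubP_of_zdCub`; never conversely).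
[cite: Balaban1985RegularSpaces, Prop. 6 p.99 (bookkeeping)] -/
theorem prop6MemberB8AtP_of_prop6Member
    (h : ∃ B₁ c₁ : ℝ, 0 ≤ B₁ ∧ 0 < c₁ ∧
      (letI : CStarAlgebra (MatA 2) := {}; B8.Prop6Printed 4 (F.L : ℝ) B₁ c₁ (fun i : ZdIdx 4 F.L => zdCub (MatA 2) F.L i))) :
    ∃ ρ₀ : ℕ, ∃ B₁ c₁ : ℝ, 1 ≤ ρ₀ ∧ 0 ≤ B₁ ∧ 0 < c₁ ∧
      (letI : CStarAlgebra (MatA 2) := {}; B8.Prop6Printed 4 (F.L : ℝ) B₁ c₁ (fun i : ZdIdx 4 F.L => zdCubP (MatA 2) F.L ρ₀ i)) := by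
  letI : CStarAlgebra (MatA 2) := {}
  obtain ⟨B₁, c₁, hB₁, hc₁, hP⟩ := h
  exact ⟨1, B₁, c₁, le_rfl, hB₁, hc₁, prop6Printed_zdCubP_of_zdCub (fun i : ZdIdx 4 F.L => i) 1 hP⟩

/-- **STUB 2′ FROM THE γ SOCKET FAMILIES AT EVERY CUBE OF EVERY MEMBER** ((E) `K0Stub2OfSockGamma.prop6MemberB8At_of_sockγ` ∘ FULL ⇒ CUT).
[cite: Balaban1985RegularSpaces, Prop. 6 p.99, Prop. 5 (1.107)–(1.108) p.94, (1.59) p.86; Balaban1984PropagatorsII, (2.3) p.224] -/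
theorem prop6MemberB8AtP_of_sockγ {B₀ B₀' cP cB9 Bbd : ℝ} (hB₀ : 0 < B₀) (hB : 2 ≤ 5 * ((4 : ℕ) : ℝ) * F.L * B₀) (hB₀' : 0 < B₀')
    (hcP : 0 < cP) (hcB9 : 0 < cB9) (hBbd : 0 ≤ Bbd) (hBd : 4 * Bbd ≤ (((4 : ℕ) : ℝ) * F.L - 1) * B₀)
    (S : letI : CStarAlgebra (MatA 2) := {};
      ∀ (i : ZdIdx 4 F.L) (c : CubeB8 4 F.L i.k i.Ω),
        SockP5base (𝔸 := MatA 2) F.L B₀ B₀' cP i.η c.k (cubeFam false F.L c.a c.M c.ρ c.k) (cubeLamS F.L c.a c.M c.ρ c.k) ∧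
        SockP5 (𝔸 := MatA 2) F.L B₀ B₀' cP i.η c.k (cubeFam false F.L c.a c.M c.ρ c.k) (cubeLamS F.L c.a c.M c.ρ c.k) ∧
        (∀ m, m ≤ c.k → SockB9P3D4β (𝔸 := MatA 2) F.L B₀ Bbd cB9 i.η m (cubeFam false F.L c.a c.M c.ρ c.k) (cubeLamS F.L c.a c.M c.ρ c.k)
          (cubeLamBP' F.L c.a c.M c.ρ c.k))) :
    ∃ ρ₀ : ℕ, ∃ B₁ c₁ : ℝ, 1 ≤ ρ₀ ∧ 0 ≤ B₁ ∧ 0 < c₁ ∧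
      (letI : CStarAlgebra (MatA 2) := {}; B8.Prop6Printed 4 (F.L : ℝ) B₁ c₁ (fun i : ZdIdx 4 F.L => zdCubP (MatA 2) F.L ρ₀ i)) :=
  prop6MemberB8AtP_of_prop6Member F (prop6MemberB8At_of_sockγ F hB₀ hB hB₀' hcP hcB9 hBbd hBd S)

end Summit.QuantumFields.YangMills.Theorems.K0Stub2PrimeJunction

end
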